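import Summits.QuantumFields.BalabanUV.Beta.EriceFlowEnclosureB12AsPrintedHistoryContagionShiftFlowZeroTangentSecondDeriv
import Summits.QuantumFields.BalabanUV.Beta.EriceFlowEnclosureB12AsPrintedHistoryContagionShiftFlowZeroTangentSecondPerturb

/-!
# Beta / EriceFlowEnclosureB12AsPrintedHistoryContagionShiftFlowZeroTangentSecondPins — ASYMPTOTIC FREEDOM IS CONTAGIOUS, part 83: THE SECOND TANGENT FLOWS AT TWO PINS.  FOR THE
# FLOW (part 14's package at e′) under the C² SHAPE (`hG`, `hGB`, `hH`, `hHB`) plus the CONTINUITY LETTER OF THE HESSIAN **`hHc`: `∀ ε > 0 ∃ ρ > 0: sup|u′ − u| ≤ ρ ⟹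
# |H u′ j i − H u j i| ≤ εθ^jθ^i`** (explicit binder; the C² analogue of part 71's `hGc`, which itself follows from `hH` + `hHB`, part 78).  (§151) A quintic difference and the
# coupling ∕ Jacobian separations of two pins WITHOUT `ẽ ≠ e` (zero when the pins coincide).  (§152) At two pins e, ẽ of ]0, e′] the DERIVED DATA of part 78 are close with the
# AF weights: **`|c̃′_{p,j} − c′_{p,j}| ≤ (8e′³∕(1−θ))·(ε_H + C_H(8e′²|δ̂| + η_W∕2))·θ^j`** (Hessian rows at two histories: `(H̃ − H)ã + H(ã − a)`, `|ã − a| ≤ w(8e′²|δ̂| +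
# η_W∕2)`) and **`|ṽ′_q − v′_q| ≤ (80e′⁴|δ̂| + 3e′²η_W)·w_q`** (the quintic difference), `η_W` the sup-distance of the two tangent flows (part 71).  (§153) Feeding part 82's
# abstract estimate: **`|V_k − Ṽ_k| ≤ explicit`, LINEAR in `(ε_H, η_G, |δ̂|, η_W)`, FOR EVERY k** — V, Ṽ bounded second tangent flows at e, ẽ.  Part 84 lets ẽ → e: the second
# tangent flow and its ultraviolet limit are continuous in the pin; Λ ∈ C²
# (β-flow team, prover 1, unit `b2b-balaban-beta-bflow-p1`, gen 43; ROW AP-I·Uc × NODE U2)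

HONEST FRAMING (page 1 of everything the β sub-cell writes): discharging `BetaPertH` makes Bałaban's UV stability UNCONDITIONAL — a
real constructive-QFT result; it is NOT the continuum limit and NOT the Clay problem.  HONEST DEPENDENCY (cell reorg 2026-08-19,
verbatim): «continuum YM on T⁴ ⇐ BetaPertH ∧ nine spine estimates (0/9 proved); BetaPertH ⇐ (D1) ∧ (D4) ∧ CAP+tail; G-an2-4 gates
asym, D1 and NE2/3/4.»  THIS MODULE DISCHARGES NOTHING: [folklore] real analysis (geometric rows, a quintic difference, part 82's abstract estimate instantiated) over node U2's
HYPOTHESIS SHAPES `T4BetaStationary.{SeqBox, MemoryProfile}`, `T4BetaFlowWellPosed.{MemFlow, solution, seqBox_shift}`, `T4CouplingMatching.{sprof}` and parts 66–71, 77, 78,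
80, 82 of this series BY NAME (NOT PRINTED for [I] = T. Bałaban, Commun. Math. Phys. **109** (1987) [Balaban1987RG1]: p. 298 says only that β_j depends on the preceding couplings;
(0.20) p. 256; Theorem 2 (0.31) p. 259 STATED WITHOUT PROOF).  The C² shape and `hHc` are OUR hypotheses, explicit binders.  Nothing of Bałaban's β is asserted.

WHAT THIS FILE PROVES (0 sorry, 0 def): §151 `quintic_sub_abs_le`, `pins_sub_abs_le`; §152 **`derivedCoeff_sub_abs_le`**, **`derivedJacobian_sub_abs_le`**;
§153 **`secondTangent_sub_abs_le`**.  NOT CLAIMED: the limit ẽ → e and Λ ∈ C² (part 84); anything about Bałaban's β; `BetaPertH`; the continuum limit of the measures; Clay.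
-/

namespace Summit.QuantumFields.BalabanUV.Beta.EriceFlowEnclosureB12AsPrintedHistoryContagionShiftFlowZeroTangentSecondPins

open Finset Filter Topology Set
open Literature.MathematicalPhysics.QuantumFieldTheory.Balaban1983to89
open Literature.MathematicalPhysics.QuantumFieldTheory.Balaban1983to89.T4CouplingMatching (sprof sprof_zero)
open Literature.MathematicalPhysics.QuantumFieldTheory.Balaban1983to89.T4BetaStationary (SeqBox MemoryProfile)
open Literature.MathematicalPhysics.QuantumFieldTheory.Balaban1983to89.T4BetaFlowWellPosed (MemFlow solution seqBox_shift)
open Summit.QuantumFields.BalabanUV.Beta.EriceFlowEnclosureB12AsPrintedHistoryContagionShiftFlowZeroTangent (row_summable_abs_le)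
open Summit.QuantumFields.BalabanUV.Beta.EriceFlowEnclosureB12AsPrintedHistoryContagionShiftFlowZeroTangentLimit (profWeight_nonneg profWeight_anti
  sum_profWeight_le)
open Summit.QuantumFields.BalabanUV.Beta.EriceFlowEnclosureB12AsPrintedHistoryContagionShiftFlowZeroTangentFlow (solution_facts tangent_data smallness_of_hs5)
open Summit.QuantumFields.BalabanUV.Beta.EriceFlowEnclosureB12AsPrintedHistoryContagionShiftFlowZeroTangentDeriv (abs_sub_pins_le_of_quotient
  invSq_sub_invSq_tendsto_zero)
open Summit.QuantumFields.BalabanUV.Beta.EriceFlowEnclosureB12AsPrintedHistoryContagionShiftFlowZeroTangentLambda (lim_quotient_sub_tangentLimit_abs_le)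
open Summit.QuantumFields.BalabanUV.Beta.EriceFlowEnclosureB12AsPrintedHistoryContagionShiftFlowZeroTangentSmooth (tangent_continuous_uniform)
open Summit.QuantumFields.BalabanUV.Beta.EriceFlowEnclosureB12AsPrintedHistoryContagionShiftFlowZeroTangentPin (chartDeriv_facts invSprof_le_two_mul jacobianDeriv_abs_le)
open Summit.QuantumFields.BalabanUV.Beta.EriceFlowEnclosureB12AsPrintedHistoryContagionShiftFlowZeroTangentSecond (gradient_continuity_of_hessian
  derivedCoeff_summable_abs_le)
open Summit.QuantumFields.BalabanUV.Beta.EriceFlowEnclosureB12AsPrintedHistoryContagionShiftFlowZeroTangentSecondFlow (jacobianDiff_abs_le mul_div_succ_le)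
open Summit.QuantumFields.BalabanUV.Beta.EriceFlowEnclosureB12AsPrintedHistoryContagionShiftFlowZeroTangentSecondPerturb (secondTangent_perturb)

noncomputable section

/-! ## §151 Two pins: the quintic difference and the coupling separation without `ẽ ≠ e` -/

/-- Fifth powers of two couplings below a common profile value σ: `|b⁵ − a⁵| ≤ 5σ⁴·|b − a|`. [folklore] -/
theorem quintic_sub_abs_le {σ a b : ℝ} (ha : 0 < a) (hb : 0 < b) (haσ : a ≤ σ) (hbσ : b ≤ σ) : |b ^ 5 - a ^ 5| ≤ 5 * σ ^ 4 * |b - a| := by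
  have hσ : 0 < σ := ha.trans_le haσ
  have e : b ^ 5 - a ^ 5 = (b ^ 4 + b ^ 3 * a + b ^ 2 * a ^ 2 + b * a ^ 3 + a ^ 4) * (b - a) := by ring
  rw [e, abs_mul, abs_of_nonneg (by positivity)]
  refine mul_le_mul_of_nonneg_right ?_ (abs_nonneg _)
  have h4b : b ^ 4 ≤ σ ^ 4 := pow_le_pow_left₀ hb.le hbσ 4
  have h4a : a ^ 4 ≤ σ ^ 4 := pow_le_pow_left₀ ha.le haσ 4
  have h3 : b ^ 3 * a ≤ σ ^ 3 * σ := mul_le_mul (pow_le_pow_left₀ hb.le hbσ 3) haσ ha.le (by positivity)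
  have h2 : b ^ 2 * a ^ 2 ≤ σ ^ 2 * σ ^ 2 := mul_le_mul (pow_le_pow_left₀ hb.le hbσ 2) (pow_le_pow_left₀ ha.le haσ 2) (by positivity) (by positivity)
  have h1 : b * a ^ 3 ≤ σ * σ ^ 3 := mul_le_mul hbσ (pow_le_pow_left₀ ha.le haσ 3) (by positivity) hσ.le
  nlinarith

/-- THE COUPLING AND JACOBIAN SEPARATIONS FOR TWO PINS OF ]0, e′], THE PINS POSSIBLY EQUAL: `|h̃_q − h_q| ≤ (2∕3)w_q|δ̂| ≤ (16∕3)e′³|δ̂|` and `|h̃_q³∕2 − h_q³∕2| ≤ 4e′²|δ̂|w_q`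
(parts 69, 80; zero if ẽ = e). [cite: Balaban1987RG1, Thm 2 (0.31) p.259 with (0.20) p.256 and p.298] -/
theorem pins_sub_abs_le {B : (ℕ → ℝ) → ℝ} {Cm θ γ bs ta gs e' : ℝ} {t : ℕ → ℝ}
    (hB : MemoryProfile Cm θ γ B) (hCm : 0 ≤ Cm) (hθ0 : 0 ≤ θ) (hθ1 : θ < 1) (hbs : 0 < bs) (hta : 0 < ta)
    (hts : SeqBox γ t) (htf : MemFlow B gs t) (hprof : ∀ m : ℕ, 1 / ta ^ 2 + bs * (m : ℝ) ≤ 1 / (t m) ^ 2)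
    (h2e' : 2 * e' ≤ γ) (hs1 : 4 * Cm * e' ≤ bs * (1 - θ))
    (hs2 : e' ^ 2 * (1 / gs ^ 2 + Cm * γ / (1 - θ) ^ 2 + (2 * Cm / ((1 - θ) * bs)) ^ 2) ≤ 3 / 4)
    (hs4 : 64 * Cm * e' ^ 3 ≤ (1 - θ) ^ 2) (hs5 : Cm * (8 * e' ^ 3 + 16 * e' / bs) ≤ (1 - θ) / 4)
    {e ee : ℝ} (he : e ∈ Ioc (0 : ℝ) e') (hee : ee ∈ Ioc (0 : ℝ) e') (q : ℕ) :
    |solution B ee q - solution B e q| ≤ 2 / 3 * (1 / (sprof (2 * e') (bs / 4) q) ^ 2 * (1 / sprof (2 * e') (bs / 4) q)) * |1 / ee ^ 2 - 1 / e ^ 2| ∧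
      |solution B ee q - solution B e q| ≤ 16 / 3 * e' ^ 3 * |1 / ee ^ 2 - 1 / e ^ 2| ∧
      |(solution B ee q) ^ 3 / 2 - (solution B e q) ^ 3 / 2|
        ≤ 4 * e' ^ 2 * |1 / ee ^ 2 - 1 / e ^ 2| * (1 / (sprof (2 * e') (bs / 4) q) ^ 2 * (1 / sprof (2 * e') (bs / 4) q)) := by
  have he' : 0 < e' := he.1.trans_le he.2
  rcases eq_or_ne ee e with heq | hne
  · subst heq
    simp only [sub_self, abs_zero, mul_zero, zero_mul]
    exact ⟨le_rfl, le_rfl, le_rfl⟩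
  · obtain ⟨h1, h2⟩ := abs_sub_pins_le_of_quotient hB hCm hθ0 hθ1 hbs hta hts htf hprof h2e' hs1 hs2 hs4 hs5 he hee hne q
    exact ⟨h1, h2, jacobianDiff_abs_le hB hCm hθ0 hθ1 hbs hta hts htf hprof h2e' hs1 hs2 hs4 hs5 he hee hne q⟩

/-! ## §152 The derived data at two pins -/

/-- **THE DERIVED COEFFICIENTS AT TWO PINS.**  Part 14's package at e′; `hG`, the Hessian profile `hH`, an (ε_H, ρ)-instance of the continuity letter `hHc`; two pins e, ẽ of ]0, e′] with
`(16∕3)e′³|δ̂| ≤ ρ`; W, W̃ the tangent flows at e, ẽ with `|W̃_q − W_q| ≤ η_W`.  THEN for every p, j: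
**`|c̃′_{p,j} − c′_{p,j}| ≤ (8e′³∕(1−θ))·(ε_H + C_H(8e′²|δ̂| + η_W∕2))·θ^j`** (`c′_{p,j} = −Σ_i H(h_{p+1+·}) j i·((h_{p+1+i}³∕2)W_{p+1+i})`; the row of
`(H̃ − H)ã + H(ã − a)` with `|ã| ≤ w`, `|ã − a| = |(ṽ − v)W̃ + v(W̃ − W)| ≤ w(8e′²|δ̂| + η_W∕2)`, charged to `w_{p+1} ≤ 8e′³`).
[cite: Balaban1987RG1, Thm 2 (0.31) p.259 with (0.20) p.256 and p.298] -/
theorem derivedCoeff_sub_abs_le {B : (ℕ → ℝ) → ℝ} {G : (ℕ → ℝ) → ℕ → ℝ} {H : (ℕ → ℝ) → ℕ → ℕ → ℝ} {Cm CH θ γ bs ta gs e' εH ρ ηW : ℝ} {t W WW : ℕ → ℝ}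
    (hB : MemoryProfile Cm θ γ B) (hCm : 0 ≤ Cm) (hθ0 : 0 ≤ θ) (hθ1 : θ < 1) (hbs : 0 < bs) (hta : 0 < ta)
    (hts : SeqBox γ t) (htf : MemFlow B gs t) (hprof : ∀ m : ℕ, 1 / ta ^ 2 + bs * (m : ℝ) ≤ 1 / (t m) ^ 2)
    (hG : ∀ u : ℕ → ℝ, SeqBox γ u → ∀ j, |G u j| ≤ Cm * θ ^ j) (hCH : 0 ≤ CH)
    (hH : ∀ u : ℕ → ℝ, SeqBox γ u → ∀ j i, |H u j i| ≤ CH * θ ^ j * θ ^ i) (hεH : 0 ≤ εH)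
    (hHcont : ∀ u u' : ℕ → ℝ, SeqBox γ u → SeqBox γ u' → (∀ j, |u' j - u j| ≤ ρ) → ∀ j i, |H u' j i - H u j i| ≤ εH * θ ^ j * θ ^ i)
    (h2e' : 2 * e' ≤ γ) (hs1 : 4 * Cm * e' ≤ bs * (1 - θ))
    (hs2 : e' ^ 2 * (1 / gs ^ 2 + Cm * γ / (1 - θ) ^ 2 + (2 * Cm / ((1 - θ) * bs)) ^ 2) ≤ 3 / 4)
    (hs4 : 64 * Cm * e' ^ 3 ≤ (1 - θ) ^ 2) (hs5 : Cm * (8 * e' ^ 3 + 16 * e' / bs) ≤ (1 - θ) / 4)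
    {e ee : ℝ} (he : e ∈ Ioc (0 : ℝ) e') (hee : ee ∈ Ioc (0 : ℝ) e') (hρ : 16 / 3 * e' ^ 3 * |1 / ee ^ 2 - 1 / e ^ 2| ≤ ρ)
    (hW : ∀ k, W k = 1 - ∑ p ∈ range k, ∑' j, G (fun i => solution B e (p + 1 + i)) j * ((solution B e (p + 1 + j)) ^ 3 / 2) * W (p + 1 + j))
    (hWM : ∀ k, |W k| ≤ 2)
    (hWW : ∀ k, WW k = 1 - ∑ p ∈ range k, ∑' j, G (fun i => solution B ee (p + 1 + i)) j * ((solution B ee (p + 1 + j)) ^ 3 / 2) * WW (p + 1 + j))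
    (hWWM : ∀ k, |WW k| ≤ 2) (hηW0 : 0 ≤ ηW) (hηW : ∀ q, |WW q - W q| ≤ ηW) (p j : ℕ) :
    |(-∑' i, H (fun l => solution B ee (p + 1 + l)) j i * ((solution B ee (p + 1 + i)) ^ 3 / 2 * WW (p + 1 + i)))
        - (-∑' i, H (fun l => solution B e (p + 1 + l)) j i * ((solution B e (p + 1 + i)) ^ 3 / 2 * W (p + 1 + i)))|
      ≤ 8 * e' ^ 3 / (1 - θ) * (εH + CH * (8 * e' ^ 2 * |1 / ee ^ 2 - 1 / e ^ 2| + ηW / 2)) * θ ^ j := by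
  have he' : 0 < e' := he.1.trans_le he.2
  have h1θ : 0 < 1 - θ := by linarith
  obtain ⟨hsb, -, -, -, -, hcube⟩ := solution_facts hB hCm hθ0 hθ1 hbs hta hts htf hprof h2e' hs1 hs2 hs4 hs5 he
  obtain ⟨hsbb, -⟩ := solution_facts hB hCm hθ0 hθ1 hbs hta hts htf hprof h2e' hs1 hs2 hs4 hs5 hee
  have hsA := (derivedCoeff_summable_abs_le hB hCm hθ0 hθ1 hbs hta hts htf hprof hG hCH hH h2e' hs1 hs2 hs4 hs5 he hW hWM p j).1
  have hsAA := (derivedCoeff_summable_abs_le hB hCm hθ0 hθ1 hbs hta hts htf hprof hG hCH hH h2e' hs1 hs2 hs4 hs5 hee hWW hWWM p j).1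
  have haa := fun q => (chartDeriv_facts hB hCm hθ0 hθ1 hbs hta hts htf hprof hG h2e' hs1 hs2 hs4 hs5 hee hWW hWWM q).2.2
  set δ : ℝ := 1 / ee ^ 2 - 1 / e ^ 2 with hδ
  set w : ℕ → ℝ := fun q => 1 / (sprof (2 * e') (bs / 4) q) ^ 2 * (1 / sprof (2 * e') (bs / 4) q) with hw
  have hwanti : ∀ {a b : ℕ}, a ≤ b → w b ≤ w a := fun hab => profWeight_anti hbs he' hab
  have hw0 : ∀ q, 0 ≤ w q := profWeight_nonneg hbs he'
  have hw8 : w (p + 1) ≤ 8 * e' ^ 3 := by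
    have h := profWeight_anti hbs he' (Nat.zero_le (p + 1))
    rw [sprof_zero (by positivity : (0:ℝ) < 2 * e')] at h
    have e8 : 1 / (1 / (2 * e')) ^ 2 * (1 / (1 / (2 * e'))) = 8 * e' ^ 3 := by field_simp; ring
    rw [e8] at h
    exact h
  have hsep : ∀ i, |solution B ee (p + 1 + i) - solution B e (p + 1 + i)| ≤ ρ := fun i =>
    (pins_sub_abs_le hB hCm hθ0 hθ1 hbs hta hts htf hprof h2e' hs1 hs2 hs4 hs5 he hee (p + 1 + i)).2.1.trans hρ
  have hHd := hHcont (fun i => solution B e (p + 1 + i)) (fun i => solution B ee (p + 1 + i)) (seqBox_shift hsb (p + 1)) (seqBox_shift hsbb (p + 1)) hsep j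
  -- |ã − a| ≤ w(8e′²|δ| + η_W∕2)
  have hda : ∀ i, |(solution B ee (p + 1 + i)) ^ 3 / 2 * WW (p + 1 + i) - (solution B e (p + 1 + i)) ^ 3 / 2 * W (p + 1 + i)|
      ≤ w (p + 1 + i) * (8 * e' ^ 2 * |δ| + ηW / 2) := by
    intro i
    set q := p + 1 + i with hq
    have hvd := (pins_sub_abs_le hB hCm hθ0 hθ1 hbs hta hts htf hprof h2e' hs1 hs2 hs4 hs5 he hee q).2.2
    have hv0 : 0 ≤ (solution B e q) ^ 3 / 2 := by have := (hsb q).1; positivity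
    have hv : (solution B e q) ^ 3 / 2 ≤ w q / 2 := by have := hcube q; simp only [hw]; linarith
    have esplit : (solution B ee q) ^ 3 / 2 * WW q - (solution B e q) ^ 3 / 2 * W q
        = ((solution B ee q) ^ 3 / 2 - (solution B e q) ^ 3 / 2) * WW q + (solution B e q) ^ 3 / 2 * (WW q - W q) := by ring
    rw [esplit]
    calc _ ≤ |((solution B ee q) ^ 3 / 2 - (solution B e q) ^ 3 / 2) * WW q| + |(solution B e q) ^ 3 / 2 * (WW q - W q)| := abs_add_le _ _
      _ ≤ 4 * e' ^ 2 * |δ| * w q * 2 + w q / 2 * ηW := by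
          rw [abs_mul, abs_mul, abs_of_nonneg hv0]
          exact add_le_add (mul_le_mul hvd (hWWM q) (abs_nonneg _) (by have := hw0 q; positivity)) (mul_le_mul hv (hηW q) (abs_nonneg _) (by have := hw0 q; positivity))
      _ = w q * (8 * e' ^ 2 * |δ| + ηW / 2) := by ring
  have hF : ∀ i, |H (fun l => solution B ee (p + 1 + l)) j i * ((solution B ee (p + 1 + i)) ^ 3 / 2 * WW (p + 1 + i))
        - H (fun l => solution B e (p + 1 + l)) j i * ((solution B e (p + 1 + i)) ^ 3 / 2 * W (p + 1 + i))|
      ≤ (θ ^ j * (εH + CH * (8 * e' ^ 2 * |δ| + ηW / 2))) * θ ^ i * (w (p + 1 + i) * 1) := by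
    intro i
    have hθj : 0 ≤ θ ^ j := pow_nonneg hθ0 j
    have hθi : 0 ≤ θ ^ i := pow_nonneg hθ0 i
    have hwq := hw0 (p + 1 + i)
    have esplit : H (fun l => solution B ee (p + 1 + l)) j i * ((solution B ee (p + 1 + i)) ^ 3 / 2 * WW (p + 1 + i))
        - H (fun l => solution B e (p + 1 + l)) j i * ((solution B e (p + 1 + i)) ^ 3 / 2 * W (p + 1 + i))
        = (H (fun l => solution B ee (p + 1 + l)) j i - H (fun l => solution B e (p + 1 + l)) j i) * ((solution B ee (p + 1 + i)) ^ 3 / 2 * WW (p + 1 + i))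
          + H (fun l => solution B e (p + 1 + l)) j i
            * ((solution B ee (p + 1 + i)) ^ 3 / 2 * WW (p + 1 + i) - (solution B e (p + 1 + i)) ^ 3 / 2 * W (p + 1 + i)) := by ring
    rw [esplit]
    calc _ ≤ |(H (fun l => solution B ee (p + 1 + l)) j i - H (fun l => solution B e (p + 1 + l)) j i) * ((solution B ee (p + 1 + i)) ^ 3 / 2 * WW (p + 1 + i))|
          + |H (fun l => solution B e (p + 1 + l)) j i
            * ((solution B ee (p + 1 + i)) ^ 3 / 2 * WW (p + 1 + i) - (solution B e (p + 1 + i)) ^ 3 / 2 * W (p + 1 + i))| := abs_add_le _ _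
      _ ≤ εH * θ ^ j * θ ^ i * w (p + 1 + i) + CH * θ ^ j * θ ^ i * (w (p + 1 + i) * (8 * e' ^ 2 * |δ| + ηW / 2)) := by
          have h1 : |(H (fun l => solution B ee (p + 1 + l)) j i - H (fun l => solution B e (p + 1 + l)) j i)
              * ((solution B ee (p + 1 + i)) ^ 3 / 2 * WW (p + 1 + i))| ≤ εH * θ ^ j * θ ^ i * w (p + 1 + i) := by
            rw [abs_mul]; exact mul_le_mul (hHd i) (haa _) (abs_nonneg _) (by positivity)
          have h2 : |H (fun l => solution B e (p + 1 + l)) j i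
              * ((solution B ee (p + 1 + i)) ^ 3 / 2 * WW (p + 1 + i) - (solution B e (p + 1 + i)) ^ 3 / 2 * W (p + 1 + i))|
              ≤ CH * θ ^ j * θ ^ i * (w (p + 1 + i) * (8 * e' ^ 2 * |δ| + ηW / 2)) := by
            rw [abs_mul]; exact mul_le_mul (hH _ (seqBox_shift hsb (p + 1)) j i) (hda i) (abs_nonneg _) (by positivity)
          exact add_le_add h1 h2
      _ = (θ ^ j * (εH + CH * (8 * e' ^ 2 * |δ| + ηW / 2))) * θ ^ i * (w (p + 1 + i) * 1) := by ring
  have hK : 0 ≤ θ ^ j * (εH + CH * (8 * e' ^ 2 * |δ| + ηW / 2)) := by positivity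
  obtain ⟨-, hrow⟩ := row_summable_abs_le hθ0 hθ1 hwanti zero_le_one hK p hF
  have e2 : (-∑' i, H (fun l => solution B ee (p + 1 + l)) j i * ((solution B ee (p + 1 + i)) ^ 3 / 2 * WW (p + 1 + i)))
        - (-∑' i, H (fun l => solution B e (p + 1 + l)) j i * ((solution B e (p + 1 + i)) ^ 3 / 2 * W (p + 1 + i)))
      = -(∑' i, H (fun l => solution B ee (p + 1 + l)) j i * ((solution B ee (p + 1 + i)) ^ 3 / 2 * WW (p + 1 + i))
          - ∑' i, H (fun l => solution B e (p + 1 + l)) j i * ((solution B e (p + 1 + i)) ^ 3 / 2 * W (p + 1 + i))) := by ring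
  rw [e2, abs_neg, ← hsAA.tsum_sub hsA]
  calc _ ≤ θ ^ j * (εH + CH * (8 * e' ^ 2 * |δ| + ηW / 2)) * (w (p + 1) * 1) / (1 - θ) := hrow
    _ ≤ θ ^ j * (εH + CH * (8 * e' ^ 2 * |δ| + ηW / 2)) * (8 * e' ^ 3 * 1) / (1 - θ) :=
        div_le_div_of_nonneg_right (mul_le_mul_of_nonneg_left (by linarith) hK) h1θ.le
    _ = 8 * e' ^ 3 / (1 - θ) * (εH + CH * (8 * e' ^ 2 * |δ| + ηW / 2)) * θ ^ j := by ring

/-- **THE DERIVED JACOBIAN AT TWO PINS**: `v′_q = −(3∕4)h_q⁵W_q`; for two pins of ]0, e′] with tangent flows η_W-close: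
**`|ṽ′_q − v′_q| ≤ (80e′⁴|δ̂| + 3e′²η_W)·w_q`** (`h̃⁵W̃ − h⁵W = (h̃⁵ − h⁵)W̃ + h⁵(W̃ − W)`, `|h̃⁵ − h⁵| ≤ 5σ⁴|h̃ − h| ≤ 80e′⁴·(2∕3)w|δ̂|`, `h⁵ ≤ σ²h³ ≤ 4e′²w`).
[cite: Balaban1987RG1, Thm 2 (0.31) p.259 with (0.20) p.256 and p.298] -/
theorem derivedJacobian_sub_abs_le {B : (ℕ → ℝ) → ℝ} {Cm θ γ bs ta gs e' ηW : ℝ} {t W WW : ℕ → ℝ}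
    (hB : MemoryProfile Cm θ γ B) (hCm : 0 ≤ Cm) (hθ0 : 0 ≤ θ) (hθ1 : θ < 1) (hbs : 0 < bs) (hta : 0 < ta)
    (hts : SeqBox γ t) (htf : MemFlow B gs t) (hprof : ∀ m : ℕ, 1 / ta ^ 2 + bs * (m : ℝ) ≤ 1 / (t m) ^ 2)
    (h2e' : 2 * e' ≤ γ) (hs1 : 4 * Cm * e' ≤ bs * (1 - θ))
    (hs2 : e' ^ 2 * (1 / gs ^ 2 + Cm * γ / (1 - θ) ^ 2 + (2 * Cm / ((1 - θ) * bs)) ^ 2) ≤ 3 / 4)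
    (hs4 : 64 * Cm * e' ^ 3 ≤ (1 - θ) ^ 2) (hs5 : Cm * (8 * e' ^ 3 + 16 * e' / bs) ≤ (1 - θ) / 4)
    {e ee : ℝ} (he : e ∈ Ioc (0 : ℝ) e') (hee : ee ∈ Ioc (0 : ℝ) e') (hWWM : ∀ k, |WW k| ≤ 2) (hηW : ∀ q, |WW q - W q| ≤ ηW) (q : ℕ) :
    |-(3 / 4 * (solution B ee q) ^ 5 * WW q) - -(3 / 4 * (solution B e q) ^ 5 * W q)|
      ≤ (80 * e' ^ 4 * |1 / ee ^ 2 - 1 / e ^ 2| + 3 * e' ^ 2 * ηW) * (1 / (sprof (2 * e') (bs / 4) q) ^ 2 * (1 / sprof (2 * e') (bs / 4) q)) := by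
  have he' : 0 < e' := he.1.trans_le he.2
  obtain ⟨hsb, -, -, hle, -, hcube⟩ := solution_facts hB hCm hθ0 hθ1 hbs hta hts htf hprof h2e' hs1 hs2 hs4 hs5 he
  obtain ⟨hsbb, -, -, hlee, -, -⟩ := solution_facts hB hCm hθ0 hθ1 hbs hta hts htf hprof h2e' hs1 hs2 hs4 hs5 hee
  obtain ⟨hd, -, -⟩ := pins_sub_abs_le hB hCm hθ0 hθ1 hbs hta hts htf hprof h2e' hs1 hs2 hs4 hs5 he hee q
  obtain ⟨-, hσ2, hσ0⟩ := invSprof_le_two_mul hbs he' q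
  set a : ℝ := solution B e q with ha
  set b : ℝ := solution B ee q with hb
  set σ : ℝ := 1 / sprof (2 * e') (bs / 4) q with hσ
  set w : ℝ := 1 / (sprof (2 * e') (bs / 4) q) ^ 2 * (1 / sprof (2 * e') (bs / 4) q) with hw
  have ha0 : 0 < a := (hsb q).1
  have hb0 : 0 < b := (hsbb q).1
  have hw0 : 0 ≤ w := profWeight_nonneg hbs he' q
  have hηW0 : 0 ≤ ηW := (abs_nonneg _).trans (hηW 0)
  have hσ4 : σ ^ 4 ≤ 16 * e' ^ 4 := by nlinarith [hσ2, sq_nonneg σ]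
  have h5 := quintic_sub_abs_le ha0 hb0 (hle q) (hlee q)
  have ha5 : a ^ 5 ≤ 4 * e' ^ 2 * w := by
    have ha2 : a ^ 2 ≤ σ ^ 2 := pow_le_pow_left₀ ha0.le (hle q) 2
    have e5 : a ^ 5 = a ^ 2 * a ^ 3 := by ring
    rw [e5]
    calc a ^ 2 * a ^ 3 ≤ σ ^ 2 * w := mul_le_mul ha2 (hcube q) (by positivity) (by positivity)
      _ ≤ 4 * e' ^ 2 * w := mul_le_mul_of_nonneg_right hσ2 hw0
  have esplit : -(3 / 4 * b ^ 5 * WW q) - -(3 / 4 * a ^ 5 * W q) = -(3 / 4) * ((b ^ 5 - a ^ 5) * WW q + a ^ 5 * (WW q - W q)) := by ring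
  rw [esplit, abs_mul, show |-(3 / 4 : ℝ)| = 3 / 4 by norm_num]
  have hin : |(b ^ 5 - a ^ 5) * WW q + a ^ 5 * (WW q - W q)| ≤ 5 * σ ^ 4 * (2 / 3 * w * |1 / ee ^ 2 - 1 / e ^ 2|) * 2 + 4 * e' ^ 2 * w * ηW := by
    calc _ ≤ |(b ^ 5 - a ^ 5) * WW q| + |a ^ 5 * (WW q - W q)| := abs_add_le _ _
      _ ≤ 5 * σ ^ 4 * (2 / 3 * w * |1 / ee ^ 2 - 1 / e ^ 2|) * 2 + 4 * e' ^ 2 * w * ηW := by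
          rw [abs_mul, abs_mul, abs_of_nonneg (by positivity : (0:ℝ) ≤ a ^ 5)]
          exact add_le_add (mul_le_mul (h5.trans (mul_le_mul_of_nonneg_left hd (by positivity))) (hWWM q) (abs_nonneg _) (by positivity))
            (mul_le_mul ha5 (hηW q) (abs_nonneg _) (by positivity))
  calc 3 / 4 * |(b ^ 5 - a ^ 5) * WW q + a ^ 5 * (WW q - W q)| ≤ 3 / 4 * (5 * σ ^ 4 * (2 / 3 * w * |1 / ee ^ 2 - 1 / e ^ 2|) * 2 + 4 * e' ^ 2 * w * ηW) :=
        mul_le_mul_of_nonneg_left hin (by norm_num)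
    _ ≤ 3 / 4 * (5 * (16 * e' ^ 4) * (2 / 3 * w * |1 / ee ^ 2 - 1 / e ^ 2|) * 2 + 4 * e' ^ 2 * w * ηW) := by
        have h0 : 0 ≤ 2 / 3 * w * |1 / ee ^ 2 - 1 / e ^ 2| := by positivity
        nlinarith
    _ = (80 * e' ^ 4 * |1 / ee ^ 2 - 1 / e ^ 2| + 3 * e' ^ 2 * ηW) * w := by ring

/-! ## §153 The second tangent flows at two pins -/

/-- **THE SECOND TANGENT FLOWS AT TWO PINS, AT EVERY SCALE AT ONCE (explicit form).**  Part 14's package at e′; `hG`, `hH`; a relative (η_G, ρ)-instance of the gradient's continuity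
(`|G u′ j − G u j| ≤ η_G·C_mθ^j`, part 71) and an (ε_H, ρ)-instance of `hHc`, same ρ; two pins e, ẽ of ]0, e′] with `(16∕3)e′³|δ̂| ≤ ρ`; W, W̃ the tangent flows (η_W-close); V, Ṽ
bounded solutions (by `M_V`, `M_Ṽ`) of the derived equations at e, ẽ.  THEN FOR EVERY k `|V_k − Ṽ_k|` is below part 82's bound with `M′ = 2`, `C₁ = 8C_He′³∕(1−θ)`, `D₁ = 6e′²`,
`η_d = 4e′²|δ̂|`, `η₁`, `η_{v1}` of §152 — LINEAR in `(ε_H, η_G, |δ̂|, η_W)`. [cite: Balaban1987RG1, Thm 2 (0.31) p.259 with (0.20) p.256 and p.298] -/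
theorem secondTangent_sub_abs_le {B : (ℕ → ℝ) → ℝ} {G : (ℕ → ℝ) → ℕ → ℝ} {H : (ℕ → ℝ) → ℕ → ℕ → ℝ}
    {Cm CH θ γ bs ta gs e' ηG εH ρ ηW MV MVV : ℝ} {t W WW V VV : ℕ → ℝ}
    (hB : MemoryProfile Cm θ γ B) (hCm : 0 ≤ Cm) (hθ0 : 0 ≤ θ) (hθ1 : θ < 1) (hbs : 0 < bs) (hta : 0 < ta)
    (hts : SeqBox γ t) (htf : MemFlow B gs t) (hprof : ∀ m : ℕ, 1 / ta ^ 2 + bs * (m : ℝ) ≤ 1 / (t m) ^ 2)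
    (hG : ∀ u : ℕ → ℝ, SeqBox γ u → ∀ j, |G u j| ≤ Cm * θ ^ j) (hCH : 0 ≤ CH)
    (hH : ∀ u : ℕ → ℝ, SeqBox γ u → ∀ j i, |H u j i| ≤ CH * θ ^ j * θ ^ i) (hηG0 : 0 ≤ ηG)
    (hcont : ∀ u u' : ℕ → ℝ, SeqBox γ u → SeqBox γ u' → (∀ j, |u' j - u j| ≤ ρ) → ∀ j, |G u' j - G u j| ≤ ηG * (Cm * θ ^ j)) (hεH : 0 ≤ εH)
    (hHcont : ∀ u u' : ℕ → ℝ, SeqBox γ u → SeqBox γ u' → (∀ j, |u' j - u j| ≤ ρ) → ∀ j i, |H u' j i - H u j i| ≤ εH * θ ^ j * θ ^ i)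
    (h2e' : 2 * e' ≤ γ) (hs1 : 4 * Cm * e' ≤ bs * (1 - θ))
    (hs2 : e' ^ 2 * (1 / gs ^ 2 + Cm * γ / (1 - θ) ^ 2 + (2 * Cm / ((1 - θ) * bs)) ^ 2) ≤ 3 / 4)
    (hs4 : 64 * Cm * e' ^ 3 ≤ (1 - θ) ^ 2) (hs5 : Cm * (8 * e' ^ 3 + 16 * e' / bs) ≤ (1 - θ) / 4)
    {e ee : ℝ} (he : e ∈ Ioc (0 : ℝ) e') (hee : ee ∈ Ioc (0 : ℝ) e') (hρ : 16 / 3 * e' ^ 3 * |1 / ee ^ 2 - 1 / e ^ 2| ≤ ρ)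
    (hW : ∀ k, W k = 1 - ∑ p ∈ range k, ∑' j, G (fun i => solution B e (p + 1 + i)) j * ((solution B e (p + 1 + j)) ^ 3 / 2) * W (p + 1 + j))
    (hWM : ∀ k, |W k| ≤ 2)
    (hWW : ∀ k, WW k = 1 - ∑ p ∈ range k, ∑' j, G (fun i => solution B ee (p + 1 + i)) j * ((solution B ee (p + 1 + j)) ^ 3 / 2) * WW (p + 1 + j))
    (hWWM : ∀ k, |WW k| ≤ 2)
    (hV : ∀ k, V k = (-∑ p ∈ range k, ∑' j,
        ((-∑' i, H (fun l => solution B e (p + 1 + l)) j i * ((solution B e (p + 1 + i)) ^ 3 / 2 * W (p + 1 + i))) * ((solution B e (p + 1 + j)) ^ 3 / 2)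
          + G (fun i => solution B e (p + 1 + i)) j * (-(3 / 4 * (solution B e (p + 1 + j)) ^ 5 * W (p + 1 + j)))) * W (p + 1 + j))
      - ∑ p ∈ range k, ∑' j, G (fun i => solution B e (p + 1 + i)) j * ((solution B e (p + 1 + j)) ^ 3 / 2) * V (p + 1 + j))
    (hVM : ∀ k, |V k| ≤ MV)
    (hVV : ∀ k, VV k = (-∑ p ∈ range k, ∑' j,
        ((-∑' i, H (fun l => solution B ee (p + 1 + l)) j i * ((solution B ee (p + 1 + i)) ^ 3 / 2 * WW (p + 1 + i))) * ((solution B ee (p + 1 + j)) ^ 3 / 2)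
          + G (fun i => solution B ee (p + 1 + i)) j * (-(3 / 4 * (solution B ee (p + 1 + j)) ^ 5 * WW (p + 1 + j)))) * WW (p + 1 + j))
      - ∑ p ∈ range k, ∑' j, G (fun i => solution B ee (p + 1 + i)) j * ((solution B ee (p + 1 + j)) ^ 3 / 2) * VV (p + 1 + j))
    (hVVM : ∀ k, |VV k| ≤ MVV) (hηW0 : 0 ≤ ηW) (hηW : ∀ q, |WW q - W q| ≤ ηW) (k : ℕ) :
    |V k - VV k|
      ≤ ((((8 * e' ^ 3 / (1 - θ) * (εH + CH * (8 * e' ^ 2 * |1 / ee ^ 2 - 1 / e ^ 2| + ηW / 2))) / 2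
              + (8 * CH * e' ^ 3 / (1 - θ)) * (4 * e' ^ 2 * |1 / ee ^ 2 - 1 / e ^ 2|) + ηG * Cm * (6 * e' ^ 2)
              + Cm * (80 * e' ^ 4 * |1 / ee ^ 2 - 1 / e ^ 2| + 3 * e' ^ 2 * ηW)) * 2
            + ((8 * CH * e' ^ 3 / (1 - θ)) / 2 + Cm * (6 * e' ^ 2)) * ηW) * (8 * e' ^ 3 + 16 * e' / bs) * 1 / (1 - θ)
          + Cm * (8 * e' ^ 3 + 16 * e' / bs) * ((ηG / 2 + 4 * e' ^ 2 * |1 / ee ^ 2 - 1 / e ^ 2|) * MVV) / (1 - θ))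
        / (1 - Cm * (8 * e' ^ 3 + 16 * e' / bs) / (2 * (1 - θ))) := by
  have he' : 0 < e' := he.1.trans_le he.2
  have h1θ : 0 < 1 - θ := by linarith
  obtain ⟨hsb, -, -, -, -, hcube⟩ := solution_facts hB hCm hθ0 hθ1 hbs hta hts htf hprof h2e' hs1 hs2 hs4 hs5 he
  obtain ⟨hsbb, -, -, -, -, hcubeb⟩ := solution_facts hB hCm hθ0 hθ1 hbs hta hts htf hprof h2e' hs1 hs2 hs4 hs5 hee
  obtain ⟨hc, hv⟩ := tangent_data (B := B) (e' := e') hG hsb hcube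
  obtain ⟨hcc, hvv⟩ := tangent_data (B := B) (e' := e') hG hsbb hcubeb
  obtain ⟨-, hq, -⟩ := smallness_of_hs5 (Cm := Cm) (bs := bs) (e' := e') hθ1 hs5
  have hη₁0 : 0 ≤ 8 * e' ^ 3 / (1 - θ) * (εH + CH * (8 * e' ^ 2 * |1 / ee ^ 2 - 1 / e ^ 2| + ηW / 2)) := by positivity
  -- derived data bounds at both pins
  have hc₁ : ∀ p j, |-∑' i, H (fun l => solution B e (p + 1 + l)) j i * ((solution B e (p + 1 + i)) ^ 3 / 2 * W (p + 1 + i))|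
      ≤ 8 * CH * e' ^ 3 / (1 - θ) * θ ^ j := fun p j => by
    rw [abs_neg]
    exact (derivedCoeff_summable_abs_le hB hCm hθ0 hθ1 hbs hta hts htf hprof hG hCH hH h2e' hs1 hs2 hs4 hs5 he hW hWM p j).2.2
  have hcc₁ : ∀ p j, |-∑' i, H (fun l => solution B ee (p + 1 + l)) j i * ((solution B ee (p + 1 + i)) ^ 3 / 2 * WW (p + 1 + i))|
      ≤ (8 * CH * e' ^ 3 / (1 - θ) + 8 * e' ^ 3 / (1 - θ) * (εH + CH * (8 * e' ^ 2 * |1 / ee ^ 2 - 1 / e ^ 2| + ηW / 2))) * θ ^ j := fun p j => by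
    rw [abs_neg]
    have h := (derivedCoeff_summable_abs_le hB hCm hθ0 hθ1 hbs hta hts htf hprof hG hCH hH h2e' hs1 hs2 hs4 hs5 hee hWW hWWM p j).2.2
    have hθj : 0 ≤ θ ^ j := pow_nonneg hθ0 j
    have hextra := mul_nonneg hη₁0 hθj
    calc _ ≤ 8 * CH * e' ^ 3 / (1 - θ) * θ ^ j := h
      _ ≤ _ := by rw [add_mul]; exact le_add_of_nonneg_right hextra
  have hv₁ : ∀ q, |-(3 / 4 * (solution B e q) ^ 5 * W q)| ≤ 6 * e' ^ 2 * (1 / (sprof (2 * e') (bs / 4) q) ^ 2 * (1 / sprof (2 * e') (bs / 4) q)) :=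
    fun q => by
    rw [abs_neg]; exact (jacobianDeriv_abs_le hB hCm hθ0 hθ1 hbs hta hts htf hprof hG h2e' hs1 hs2 hs4 hs5 he hW hWM q).2
  have hvv₁ : ∀ q, |-(3 / 4 * (solution B ee q) ^ 5 * WW q)| ≤ 6 * e' ^ 2 * (1 / (sprof (2 * e') (bs / 4) q) ^ 2 * (1 / sprof (2 * e') (bs / 4) q)) :=
    fun q => by
    rw [abs_neg]; exact (jacobianDeriv_abs_le hB hCm hθ0 hθ1 hbs hta hts htf hprof hG h2e' hs1 hs2 hs4 hs5 hee hWW hWWM q).2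
  -- the five closeness letters
  have hsep : ∀ p i, |solution B ee (p + 1 + i) - solution B e (p + 1 + i)| ≤ ρ := fun p i =>
    (pins_sub_abs_le hB hCm hθ0 hθ1 hbs hta hts htf hprof h2e' hs1 hs2 hs4 hs5 he hee (p + 1 + i)).2.1.trans hρ
  have hηG : ∀ p j, |G (fun i => solution B ee (p + 1 + i)) j - G (fun i => solution B e (p + 1 + i)) j| ≤ ηG * (Cm * θ ^ j) := fun p j =>
    hcont _ _ (seqBox_shift hsb (p + 1)) (seqBox_shift hsbb (p + 1)) (hsep p) j
  have hηd : ∀ q, |(solution B ee q) ^ 3 / 2 - (solution B e q) ^ 3 / 2|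
      ≤ 4 * e' ^ 2 * |1 / ee ^ 2 - 1 / e ^ 2| * (1 / (sprof (2 * e') (bs / 4) q) ^ 2 * (1 / sprof (2 * e') (bs / 4) q)) := fun q =>
    (pins_sub_abs_le hB hCm hθ0 hθ1 hbs hta hts htf hprof h2e' hs1 hs2 hs4 hs5 he hee q).2.2
  have hη₁ := derivedCoeff_sub_abs_le hB hCm hθ0 hθ1 hbs hta hts htf hprof hG hCH hH hεH hHcont h2e' hs1 hs2 hs4 hs5 he hee hρ hW hWM hWW hWWM hηW0 hηW
  have hηv1 := derivedJacobian_sub_abs_le hB hCm hθ0 hθ1 hbs hta hts htf hprof h2e' hs1 hs2 hs4 hs5 he hee hWWM hηW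
  exact secondTangent_perturb hCm (by positivity : 0 ≤ 8 * CH * e' ^ 3 / (1 - θ)) (by positivity : (0:ℝ) ≤ 6 * e' ^ 2) hθ0 hθ1
    (profWeight_nonneg hbs he') (fun hab => profWeight_anti hbs he' hab) (sum_profWeight_le hbs he') hq zero_le_two
    hc hcc hv hvv hc₁ hcc₁ hv₁ hvv₁ hWM hWWM hV hVM hVV hVVM hηG0 hηG (by positivity) hηd hη₁0 hη₁ (by positivity) hηv1 hηW0 hηW k

end

end Summit.QuantumFields.BalabanUV.Beta.EriceFlowEnclosureB12AsPrintedHistoryContagionShiftFlowZeroTangentSecondPins
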